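import Summits.MatrixMultiplication.OmegaCensus.SmallFormats.RankOnePlaneCapGaugeV12
import HarnessLib

/-!
# ω-census family (a): the row-plane law BLOCK of the x2gs encoder is satisfied by every real scheme

Cell `pub-omega` (unit `pub-omega-eng1`, gen 33), topic `Summits/MatrixMultiplication/OmegaCensus`
(sub-folder `SmallFormats`). Framing (verbatim): lottery ticket; floor = certified bounds/negative
ranges. HONEST FRAMING: bookkeeping for the second gauge-SAT encoder (ENG1 x2gs v1.1,
`JOB_ROWLAWS=1`) of the `𝔽₃` `⟨2,2,5⟩@17` X-marginal census. Its 'row-law block' for a SATURATED ROW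
plane `λ` (X-forms of `R`, `|R| = 2r − 6n = 4`, vanish on `{λ zᵀ}`) introduces fresh vectors
`b₀, b₁ ∈ k⁵` and coefficients and imposes
* `rowmem`: every row of every Y-coefficient matrix `G_i` (`i ∈ R`; `G_i[μ][ν] = g_i(E_{μν})`) is a
  combination of `b₀, b₁`;
* `rowperp`: `(θᵀ W_i) · b_m = 0` for `i ∉ R`, `m ∈ {0,1}`, for a fixed `θ ≠ 0`, `θ ⊥ λ`.
The encoder's README derived on the desk, from the tree law `card_vanishing_quant_eq`, that a real
scheme satisfies this block with `b` = a basis of `F = E^⊥` (`E = span{θᵀW_i : i ∉ R}`, `dim E = 3`).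
`rowlaw_block_witness_225` below IS that derivation as a theorem (so the block is sound for UNSAT
verdicts by citation, not by a desk step): for every `⟨2,2,5⟩`-computation with 17 products over any
field and every saturated row plane there are `θ ≠ 0`, `θ ⊥ λ`, and independent `b₀, b₁` satisfying
`rowmem` and `rowperp`. The law's `θ` is unique up to a nonzero scalar (`c = 2`); both clause
families are invariant under `θ ↦ sθ`, and over `𝔽₃` the encoder's fixed `θ(λ)` is `±` the law's
(`perp_eq_or_eq_neg_zmod3`, by `decide`) — the same remark covers the `θ₁, θ₂` of
`gauge_normal_form_v12`. Not a bound on any rank, not progress on `ω`.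
-/

namespace Summit.MatrixMultiplication.OmegaCensus.RankOnePlaneCapGeneral

open Module Matrix Literature.Computability.AlgebraicComplexity

variable {k : Type*} [Field k] {c m n : ℕ} {ι : Type*} [Fintype ι]

/-- A single-row matrix as a combination of elementary matrices:
`e_μ vᵀ = ∑_ν v_ν · E_{μν}`. -/
theorem vecMulVec_single_eq_sum (μ : Fin m) (v : Fin n → k) :
    vecMulVec (Pi.single μ (1 : k)) v = ∑ ν, v ν • Matrix.single μ ν (1 : k) := by
  ext a b
  rw [Matrix.sum_apply, Finset.sum_eq_single_of_mem b (Finset.mem_univ b)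
    (fun ν _ hν => by rw [Matrix.smul_apply, Matrix.single_apply_of_col_ne μ a hν, smul_zero])]
  rw [Matrix.smul_apply, vecMulVec_apply, Pi.single_apply, Matrix.single_apply, smul_eq_mul]
  by_cases h : a = μ
  · rw [if_pos h, if_pos ⟨h.symm, rfl⟩, one_mul, mul_one]
  · rw [if_neg h, if_neg (fun hc => h hc.1.symm), zero_mul, mul_zero]

/-- **Rows of `G_i` are orthogonal to `E`.** If the common zeros of the Y-forms of `R` are exactly
the matrices with all rows in `E` (the law's characterisation), then for `i ∈ R` every row
`G_i[μ] = (g_i(E_{μν}))_ν` of the Y-coefficient matrix is dot-orthogonal to `E`. -/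
theorem gRow_dot_eq_zero_of_char (β : BilinComp (mulBilin k c m n) ι) (R : Finset ι)
    (E : Submodule k (Fin n → k))
    (hchar : ∀ Y : Matrix (Fin m) (Fin n) k, (∀ i ∈ R, β.g i Y = 0) ↔ ∀ μ, Y μ ∈ E)
    {i : ι} (hi : i ∈ R) (μ : Fin m) {e : Fin n → k} (he : e ∈ E) :
    (fun ν => β.g i (Matrix.single μ ν (1 : k))) ⬝ᵥ e = 0 := by
  classical
  have hY : β.g i (vecMulVec (Pi.single μ (1 : k)) e) = 0 := by
    refine (hchar _).mpr (fun μ' => ?_) i hi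
    by_cases h : μ' = μ
    · have : vecMulVec (Pi.single μ (1 : k)) e μ' = e := by
        funext ν; simp [vecMulVec_apply, h]
      rw [this]; exact he
    · have : vecMulVec (Pi.single μ (1 : k)) e μ' = 0 := by
        funext ν; simp [vecMulVec_apply, h]
      rw [this]; exact E.zero_mem
  rw [vecMulVec_single_eq_sum, map_sum] at hY
  simp only [map_smul, smul_eq_mul] at hY
  rw [dotProduct_comm]
  simpa [dotProduct] using hY

/-- **The row-law block is satisfied by every real scheme** (`⟨2,2,5⟩`, 17 products, any field).
For a saturated row plane `λ` (`|R| = 4` X-forms vanishing on `{λ zᵀ}`) there are `θ ≠ 0` with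
`θ ⊥ λ` and linearly independent `b₀, b₁ ∈ k⁵` (a basis of `F = E^⊥`) such that
(`rowmem`) every row of `G_i`, `i ∈ R`, is `a b₀ + a' b₁`, and (`rowperp`) `(θᵀW_i) · b_m = 0` for
all `i ∉ R` — exactly the two clause families of the x2gs v1.1 block, with its `f_r = 2` fresh
vectors. -/
theorem rowlaw_block_witness_225 [DecidableEq ι] (h17 : Fintype.card ι = 17)
    (β : BilinComp (mulBilin k 2 2 5) ι) {lam : Fin 2 → k} (hlam : lam ≠ 0) (R : Finset ι)
    (hR : ∀ i ∈ R, ∀ z : Fin 2 → k, β.f i (vecMulVec lam z) = 0) (hc : R.card = 4) :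
    ∃ θ : Fin 2 → k, θ ≠ 0 ∧ θ ⬝ᵥ lam = 0 ∧
      ∃ b₀ b₁ : Fin 5 → k, LinearIndependent k ![b₀, b₁] ∧
        (∀ i ∈ R, ∀ μ : Fin 2, ∃ a a' : k,
          ∀ ν, β.g i (Matrix.single μ ν (1 : k)) = a * b₀ ν + a' * b₁ ν) ∧
        (∀ i, i ∉ R → (θ ᵥ* β.w i) ⬝ᵥ b₀ = 0 ∧ (θ ᵥ* β.w i) ⬝ᵥ b₁ = 0) := by
  classical
  have hcR : (Finset.univ \ R).card + R.card = Fintype.card ι := by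
    rw [Finset.card_sdiff_add_card_eq_card (Finset.subset_univ R), Finset.card_univ]
  obtain ⟨θ, E, hθ, hθlam, hE, hdim, hchar, -⟩ :=
    card_vanishing_quant_eq (c := 2) (m := 2) (by norm_num) (by norm_num) β hlam R hR (by omega)
  have hE3 : finrank k E = 3 := by omega
  -- `F = E^⊥` is a plane; take a basis
  obtain ⟨F, hF2, hmemF⟩ := exists_dotOrthogonal_fin5 E hE3
  obtain ⟨b₀, b₁, hb₀, hb₁, hli, hspan⟩ := exists_pair_of_finrank_eq_two F hF2
  refine ⟨θ, hθ, hθlam, b₀, b₁, hli, fun i hi μ => ?_, fun i hi => ?_⟩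
  · -- `rowmem`: the row `G_i[μ]` lies in `F`
    have hrow : (fun ν => β.g i (Matrix.single μ ν (1 : k))) ∈ F :=
      (hmemF _).mpr fun e he => gRow_dot_eq_zero_of_char β R E hchar hi μ he
    obtain ⟨a, a', h⟩ := hspan _ hrow
    exact ⟨a, a', fun ν => by
      have := congrFun h ν
      simpa [Pi.add_apply, Pi.smul_apply, smul_eq_mul] using this.symm⟩
  · -- `rowperp`: `θᵀW_i ∈ E` and `b_m ∈ F = E^⊥`
    have hmem : θ ᵥ* β.w i ∈ E := by
      rw [hE]; exact Submodule.subset_span ⟨i, by simp [hi], rfl⟩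
    exact ⟨by rw [dotProduct_comm]; exact (hmemF b₀).mp hb₀ _ hmem,
      by rw [dotProduct_comm]; exact (hmemF b₁).mp hb₁ _ hmem⟩

/-- **`θ ⊥ λ` is determined up to sign over `𝔽₃`** (`c = 2`): for `λ ≠ 0`, any two nonzero
`θ, θ' ⊥ λ` satisfy `θ' = θ` or `θ' = −θ` — so the encoders' fixed choice `θ(λ)` may replace the
`θ` of `rowlaw_block_witness_225` / the `θ₁, θ₂` of `gauge_normal_form_v12`, all of whose conditions
are invariant under `θ ↦ −θ`. (`decide` over the `3⁶` cases.) -/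
theorem perp_eq_or_eq_neg_zmod3 :
    ∀ lam θ θ' : Fin 2 → ZMod 3, lam ≠ 0 → θ ≠ 0 → θ' ≠ 0 → θ ⬝ᵥ lam = 0 → θ' ⬝ᵥ lam = 0 →
      θ' = θ ∨ θ' = -θ := by
  decide

/-! ### The same block for every format `⟨2,2,n⟩` at saturation (`|R| = 2r − 6n`, `f_r = r − 3n`)

Appended (ENG1 gen 33): the general form matching the encoder's `build_case` (any `n`, `f_r` fresh
vectors), so the row-law blocks of the CONTROL marginals (`⟨2,2,3⟩@11`, `⟨2,2,4⟩@14`: `f_r = 2`;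
`⟨2,2,5⟩@18`: `|R| = 6`, `f_r = 3`) are covered by the same citation as the census format. -/

/-- For a `d`-dimensional `E ≤ kⁿ`, the dot-orthogonal `E^⊥ = {x : x · e = 0 ∀ e ∈ E}` is a subspace
of dimension `n − d` (any field; `E^⊥` may meet `E`, the dimension count is unaffected). -/
theorem exists_dotOrthogonal (E : Submodule k (Fin n → k)) {d : ℕ} (hE : finrank k E = d) :
    ∃ F : Submodule k (Fin n → k), finrank k F + d = n ∧ ∀ x, x ∈ F ↔ ∀ e ∈ E, x ⬝ᵥ e = 0 := by
  classical
  obtain ⟨B, C, hCB, hBE⟩ := exists_colMatrix_leftInverse E hE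
  -- the columns of `B` span `E`
  have hspan : Submodule.span k (Set.range fun a : Fin d => fun ν => B ν a) = E := by
    have hli : LinearIndependent k (fun a : Fin d => fun ν => B ν a) := by
      rw [Fintype.linearIndependent_iff]
      intro g hg a
      have h1 : B *ᵥ g = 0 := by
        ext ν
        have := congrFun hg ν
        simpa [Matrix.mulVec, dotProduct, Finset.sum_apply, Pi.smul_apply, mul_comm] using this
      have h2 : C *ᵥ (B *ᵥ g) = g := by rw [Matrix.mulVec_mulVec, hCB, Matrix.one_mulVec]
      rw [h1, Matrix.mulVec_zero] at h2
      exact (congrFun h2 a).symm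
    refine Submodule.eq_of_le_of_finrank_eq ?_ ?_
    · rw [Submodule.span_le, Set.range_subset_iff]; exact hBE
    · rw [finrank_span_eq_card hli, Fintype.card_fin, hE]
  let φ : (Fin n → k) →ₗ[k] (Fin d → k) := Matrix.toLin' Bᵀ
  refine ⟨LinearMap.ker φ, ?_, fun x => ?_⟩
  · have hsurj : LinearMap.range φ = ⊤ := by
      rw [LinearMap.range_eq_top]
      intro y
      refine ⟨Cᵀ *ᵥ y, ?_⟩
      show Bᵀ *ᵥ (Cᵀ *ᵥ y) = y
      rw [Matrix.mulVec_mulVec, ← Matrix.transpose_mul, hCB, Matrix.transpose_one,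
        Matrix.one_mulVec]
    have h := LinearMap.finrank_range_add_finrank_ker φ
    rw [hsurj, finrank_top, Module.finrank_fin_fun, Module.finrank_fin_fun] at h
    omega
  · rw [LinearMap.mem_ker]
    constructor
    · intro hx e he
      rw [← hspan] at he
      refine Submodule.span_induction (fun e' he' => ?_) ?_ (fun e₁ e₂ _ _ h₁ h₂ => ?_)
        (fun a e' _ h' => ?_) he
      · obtain ⟨a, rfl⟩ := he'
        have := congrFun hx a
        simpa [φ, Matrix.toLin'_apply, Matrix.mulVec, dotProduct, Matrix.transpose_apply,
          mul_comm] using this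
      · exact dotProduct_zero x
      · rw [dotProduct_add, h₁, h₂, add_zero]
      · rw [dotProduct_smul, h', smul_zero]
    · intro h
      ext a
      have := h _ (hBE a)
      simpa [φ, Matrix.toLin'_apply, Matrix.mulVec, dotProduct, Matrix.transpose_apply,
        mul_comm] using this

/-- **The row-law block is satisfied by every real scheme — every format `⟨2,2,n⟩` at saturation.**
For a computation of `⟨2,2,n⟩` with `r` products over any field and a row plane `λ ≠ 0` whose
vanishing set `R` has `|R| = 2r − 6n` (saturation), and `f + 3n = r` (`f = f_r`, the number of fresh
vectors of the block): there are `θ ≠ 0`, `θ ⊥ λ`, and a linearly independent family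
`b : Fin f → kⁿ` (a basis of `F = E^⊥`) with (`rowmem`) every row of `G_i`, `i ∈ R`, in the span of
`b` with explicit coefficients, and (`rowperp`) `(θᵀW_i) · b_j = 0` for `i ∉ R`. -/
theorem rowlaw_block_witness_22n [DecidableEq ι] (β : BilinComp (mulBilin k 2 2 n) ι)
    {lam : Fin 2 → k} (hlam : lam ≠ 0) (R : Finset ι)
    (hR : ∀ i ∈ R, ∀ z : Fin 2 → k, β.f i (vecMulVec lam z) = 0)
    (hsat : R.card + 6 * n = 2 * Fintype.card ι) {f : ℕ} (hf : f + 3 * n = Fintype.card ι) :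
    ∃ θ : Fin 2 → k, θ ≠ 0 ∧ θ ⬝ᵥ lam = 0 ∧
      ∃ b : Fin f → Fin n → k, LinearIndependent k b ∧
        (∀ i ∈ R, ∀ μ : Fin 2, ∃ a : Fin f → k,
          ∀ ν, β.g i (Matrix.single μ ν (1 : k)) = ∑ j, a j * b j ν) ∧
        (∀ i, i ∉ R → ∀ j, (θ ᵥ* β.w i) ⬝ᵥ b j = 0) := by
  classical
  have hcR : (Finset.univ \ R).card + R.card = Fintype.card ι := by
    rw [Finset.card_sdiff_add_card_eq_card (Finset.subset_univ R), Finset.card_univ]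
  obtain ⟨θ, E, hθ, hθlam, hE, hdim, hchar, -⟩ :=
    card_vanishing_quant_eq (c := 2) (m := 2) (by norm_num) (by norm_num) β hlam R hR (by omega)
  -- `dim E = 4n − r`, so `dim F = r − 3n = f`
  obtain ⟨F, hFd, hmemF⟩ := exists_dotOrthogonal E rfl
  have hFf : finrank k F = f := by omega
  let bF := Module.finBasisOfFinrankEq k F hFf
  refine ⟨θ, hθ, hθlam, fun j => (bF j : Fin n → k), ?_, fun i hi μ => ?_, fun i hi j => ?_⟩
  · exact bF.linearIndependent.map' F.subtype F.ker_subtype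
  · -- `rowmem`: the row `G_i[μ]` lies in `F`; read off its coordinates in the basis
    have hrow : (fun ν => β.g i (Matrix.single μ ν (1 : k))) ∈ F :=
      (hmemF _).mpr fun e he => gRow_dot_eq_zero_of_char β R E hchar hi μ he
    refine ⟨fun j => bF.repr ⟨_, hrow⟩ j, fun ν => ?_⟩
    have h := congrArg Subtype.val (bF.sum_repr ⟨_, hrow⟩)
    have h' := congrFun h ν
    simp only [Submodule.coe_sum, Submodule.coe_smul, Finset.sum_apply, Pi.smul_apply,
      smul_eq_mul] at h'
    exact h'.symm
  · -- `rowperp`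
    have hmem : θ ᵥ* β.w i ∈ E := by
      rw [hE]; exact Submodule.subset_span ⟨i, by simp [hi], rfl⟩
    rw [dotProduct_comm]; exact (hmemF _).mp (bF j).2 _ hmem

end Summit.MatrixMultiplication.OmegaCensus.RankOnePlaneCapGeneral
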